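/-
Copyright (c) 2026. All rights reserved.
Released under Apache 2.0 license as described in the file LICENSE.
Authors: abc-iut cell — seat abc-iut-w4-d104 (gen 3): rows (b) of the sub-DAG of [AbsTopIII] Cor 2.9 at the disc
CHART model (L4-lead RULING #6j), over the pull-back structure `LocalLinearHolStructure.comap` (p432115).
-/
import Literature.AnabelianGeometry.AbsoluteAnabelian.ArchimedeanReconstructionCor29ChartModelProofs
import Literature.AnabelianGeometry.AbsoluteAnabelian.LocalLinearHolStructureComap
import HarnessLib

/-!
# [AbsTopIII] Cor 2.9 (b) at the disc CHART model: the scalar of a germ automorphism, the field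
# isomorphism `𝒜_x ∪ {0} ⥲ k_v`, and its compatibility as `x` varies — for the chart-transported structure

S. Mochizuki, *Topics in absolute anabelian geometry III* (bib key `MochizukiAbsTopIII2015`), Cor 2.9 (b),
kurims p.65 l.14–29 (paraphrase): letting the neighbourhoods `U_X` of a fixed NF-point `x` vary and using
compatibility with the natural actions of `𝒜_x` and `k_v` on the domain and codomain of `ι_{U_X,x}`, the
`ι_{U_X,x}` determine an isomorphism of topological fields `𝒜_x ∪ {0} ⥲ k_v`; as `x` varies these are
compatible with the isomorphisms `𝒜_{x₁} ∪ {0} ⥲ 𝒜_{x₂} ∪ {0}` of Cor 2.7 (e).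

PROOF-ONLY sequel of `ArchimedeanReconstructionCor29ChartModelProofs.lean` (rows (a) at the chart model).
The local linear holomorphic structure of the chart model is the PULL-BACK `planeStructure.comap e`
(`LocalLinearHolStructureComap.lean`) of abc-iut-w5-d225's plane structure along the chart `e : V → 𝔻`:
`𝒜_x = germAut (e x)`, acting near `x` by the chart-conjugated affine maps
`act_x u v := e⁻¹(e x + c_u (e v − e x))` (`c_u = Cor29Model.mult (e x) u` the multiplier), with the
transported local additive structure `a +ₓ b := e⁻¹(e a + e b − e x)` and
`ι_x(v) := ((e⁻¹)′(e x) · (e v − e x)) • id` (general, not necessarily centred, chart).  Over w5-d225's typed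
statements (p414208):

* `actionScalar_chart` (b.r1, `AR.Cor29.ActionScalar`) — each `u ∈ 𝒜_x` has a UNIQUE scalar, its multiplier;
* `scalarFieldIso_chart` (b.r2, `AR.Cor29.ScalarFieldIso`) — the pinned isomorphism `𝒜_x ⥲ ℂ^×` is
  `Cor29Model.mult (e x)`, additive for the action-defined sum w.r.t. the transported `+ₓ`;
* `scalar_restrict_chart` (b.r3) — independence of the neighbourhood;
* `scalarCompatibleWithTrans_chart` (b.r4, `AR.Cor29.ScalarCompatibleWithTrans`) — compatibility with the
  transition isomorphisms of the transported structure.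

HONEST SCOPE: model level (`V` a planar Aut-holomorphic disc with chart `(e, e')`); refereed pre-IUT
material; nothing here bears on the disputed [IUTchIII] Cor. 3.12; typed ≠ endorsed.
-/

noncomputable section

namespace Literature.AnabelianGeometry.AbsoluteAnabelian

open _root_.Complex _root_.Set _root_.Topology _root_.Filter _root_.Metric _root_.Function
open Literature.Analysis.Complex ArchimedeanReconstruction ArchimedeanReconstruction.Cor29

namespace ArchimedeanReconstruction.Cor29ChartModel

variable {V : Set ℂ} {e e' : ℂ → ℂ}

/-! ### The chart-transported action of `𝒜_x` and the scalar it induces -/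

/-- Near `x`, the chart-conjugated affine action of `u ∈ 𝒜_x` (multiplier `c`) reads, in the chart,
`e(act_x u v) = e x + c (e v − e x)`. [cite: MochizukiAbsTopIII2015, Corollary 2.9 (b) p.65] -/
theorem eventually_chart_act (hV : IsOpen V) (he : DifferentiableOn ℂ e V) (hem : MapsTo e V (ball 0 1))
    (hr : ∀ w ∈ ball (0 : ℂ) 1, e (e' w) = w) {x : ℂ} (hx : x ∈ V) (c : ℂ) :
    ∀ᶠ v in 𝓝 x, e x + c * (e v - e x) ∈ ball (0 : ℂ) 1 ∧
      e (e' (e x + c * (e v - e x))) = e x + c * (e v - e x) := by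
  have hcont : ContinuousAt (fun v => e x + c * (e v - e x)) x :=
    continuousAt_const.add (continuousAt_const.mul
      (((he.differentiableAt (hV.mem_nhds hx)).continuousAt).sub continuousAt_const))
  have h0 : e x + c * (e x - e x) ∈ ball (0 : ℂ) 1 := by rw [sub_self, mul_zero, add_zero]; exact hem hx
  have hmem : ∀ᶠ v in 𝓝 x, e x + c * (e v - e x) ∈ ball (0 : ℂ) 1 :=
    hcont.preimage_mem_nhds (isOpen_ball.mem_nhds h0)
  filter_upwards [hmem] with v hv
  exact ⟨hv, hr _ hv⟩

/-- A property holding near `x` holds at some point `v ∈ V`, `v ≠ x` (so `e v ≠ e x`). (Auxiliary.)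
[cite: MochizukiAbsTopIII2015, Corollary 2.9 (b) p.65] -/
theorem exists_ne_mem_of_eventually (hV : IsOpen V) (hl : ∀ z ∈ V, e' (e z) = z) {x : ℂ} (hx : x ∈ V)
    {P : ℂ → Prop} (h : ∀ᶠ v in 𝓝 x, P v) : ∃ v, v ∈ V ∧ e v ≠ e x ∧ P v := by
  haveI : (𝓝[≠] x).NeBot := NormedField.nhdsNE_neBot x
  have h' : ∀ᶠ v in 𝓝[≠] x, (P v ∧ v ∈ V) ∧ v ∈ ({x}ᶜ : Set ℂ) :=
    ((h.and (hV.mem_nhds hx)).filter_mono nhdsWithin_le_nhds).and self_mem_nhdsWithin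
  obtain ⟨v, ⟨hvP, hvV⟩, hv⟩ := h'.exists
  refine ⟨v, hvV, fun heq => ?_, hvP⟩
  exact (Set.mem_compl_singleton_iff.1 hv) (by rw [← hl v hvV, ← hl x hx, heq])

/-- In the chart, `ι_x(act_x u v) = c_u • ι_x(v)` near `x` (`c_u` the multiplier of `u`).
[cite: MochizukiAbsTopIII2015, Corollary 2.9 (b) p.65] -/
theorem iota_chartAct_eventually (hV : IsOpen V) (he : DifferentiableOn ℂ e V) (hem : MapsTo e V (ball 0 1))
    (hr : ∀ w ∈ ball (0 : ℂ) 1, e (e' w) = w) {x : ℂ} (hx : x ∈ V)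
    (u : (Cor29Model.planeStructure.comap e).A x) :
    ∀ᶠ v in 𝓝 x, ((deriv e' (e x) * (e (e' (e x + (((Cor29Model.mult (e x) : (Cor29Model.planeStructure.comap e).A x ≃ₜ* ℂˣ) u : ℂˣ) : ℂ) * (e v - e x))) - e x)) •
        (LinearMap.id : ℂ →ₗ[ℂ] ℂ)) =
      (((Cor29Model.mult (e x) : (Cor29Model.planeStructure.comap e).A x ≃ₜ* ℂˣ) u : ℂˣ) : ℂ) • ((deriv e' (e x) * (e v - e x)) • (LinearMap.id : ℂ →ₗ[ℂ] ℂ)) := by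
  filter_upwards [eventually_chart_act hV he hem hr hx (((Cor29Model.mult (e x) : (Cor29Model.planeStructure.comap e).A x ≃ₜ* ℂˣ) u : ℂˣ) : ℂ)] with v hv
  refine LinearMap.ext fun ω => ?_
  simp only [LinearMap.smul_apply, LinearMap.id_apply, smul_eq_mul]
  rw [hv.2]
  ring

/-- **Row Cor-29.b.r1 at the chart model** (`ActionScalar`): with `𝒜_x` the germ group of the transported
structure `planeStructure.comap e` at `x` (= `germAut (e x)`), acting near `x` by
`act_x u v := e⁻¹(e x + c_u (e v − e x))`, and `ι_x(v) := ((e⁻¹)′(e x) · (e v − e x)) • id`: for every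
`u ∈ 𝒜_x` there is a UNIQUE scalar `a ∈ ℂ^×` with `ι_x(act_x u v) = a · ι_x(v)` near `x`, namely the
multiplier `c_u`. [cite: MochizukiAbsTopIII2015, Corollary 2.9 (b) p.65] -/
theorem actionScalar_chart (hV : IsOpen V) (he : DifferentiableOn ℂ e V) (hem : MapsTo e V (ball 0 1))
    (he' : DifferentiableOn ℂ e' (ball 0 1)) (hl : ∀ z ∈ V, e' (e z) = z)
    (hr : ∀ w ∈ ball (0 : ℂ) 1, e (e' w) = w) {x : ℂ} (hx : x ∈ V) :
    ActionScalar (𝕜 := ℂ) (A := (Cor29Model.planeStructure.comap e).A x)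
      (fun u v => e' (e x + (((Cor29Model.mult (e x) : (Cor29Model.planeStructure.comap e).A x ≃ₜ* ℂˣ) u : ℂˣ) : ℂ) * (e v - e x))) x
      (fun v => (deriv e' (e x) * (e v - e x)) • (LinearMap.id : ℂ →ₗ[ℂ] ℂ)) := by
  have hd : deriv e' (e x) ≠ 0 := chart_deriv_symm_ne_zero hV he hem he' hl hx
  intro u
  beta_reduce
  refine ⟨(Cor29Model.mult (e x) : (Cor29Model.planeStructure.comap e).A x ≃ₜ* ℂˣ) u, ?_, fun a ha => ?_⟩
  · exact iota_chartAct_eventually hV he hem hr hx u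
  · beta_reduce at ha
    obtain ⟨v, -, hne, hv⟩ := exists_ne_mem_of_eventually hV hl hx
      (ha.and (eventually_chart_act hV he hem hr hx (((Cor29Model.mult (e x) : (Cor29Model.planeStructure.comap e).A x ≃ₜ* ℂˣ) u : ℂˣ) : ℂ)))
    obtain ⟨hva, -, hv2⟩ := hv
    have h1 := LinearMap.congr_fun hva 1
    simp only [LinearMap.smul_apply, LinearMap.id_apply, smul_eq_mul, mul_one] at h1
    rw [hv2] at h1
    have hvx : e v - e x ≠ 0 := sub_ne_zero.2 hne
    have h2 : deriv e' (e x) * ((((Cor29Model.mult (e x) : (Cor29Model.planeStructure.comap e).A x ≃ₜ* ℂˣ) u : ℂˣ) : ℂ) * (e v - e x)) =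
        deriv e' (e x) * ((a : ℂ) * (e v - e x)) := by
      rw [show e x + (((Cor29Model.mult (e x) : (Cor29Model.planeStructure.comap e).A x ≃ₜ* ℂˣ) u : ℂˣ) : ℂ) * (e v - e x) - e x =
        (((Cor29Model.mult (e x) : (Cor29Model.planeStructure.comap e).A x ≃ₜ* ℂˣ) u : ℂˣ) : ℂ) * (e v - e x) by ring] at h1
      rw [h1]; ring
    have h3 := mul_right_cancel₀ hvx (mul_left_cancel₀ hd h2)
    exact Units.ext h3.symm

/-- **Row Cor-29.b.r2 at the chart model** (`ScalarFieldIso`): the isomorphism of topological fields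
`𝒜_x ∪ {0} ⥲ k_v` pinned by `ι_x` is the multiplier `Cor29Model.mult (e x) : 𝒜_x ⥲ ℂ^×` of the
transported structure `planeStructure.comap e` — it is the scalar of the action, and it is additive for the
action-defined sum relative to the transported local additive structure `a +ₓ b := e⁻¹(e a + e b − e x)`.
[cite: MochizukiAbsTopIII2015, Corollary 2.9 (b) p.65] -/
theorem scalarFieldIso_chart (hV : IsOpen V) (he : DifferentiableOn ℂ e V) (hem : MapsTo e V (ball 0 1))
    (hl : ∀ z ∈ V, e' (e z) = z) (hr : ∀ w ∈ ball (0 : ℂ) 1, e (e' w) = w) {x : ℂ} (hx : x ∈ V) :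
    ScalarFieldIso (𝕜 := ℂ) (Cor29Model.planeStructure.comap e) x
      (fun u v => e' (e x + (((Cor29Model.mult (e x) : (Cor29Model.planeStructure.comap e).A x ≃ₜ* ℂˣ) u : ℂˣ) : ℂ) * (e v - e x)))
      (fun a b => e' (e a + e b - e x))
      (fun v => (deriv e' (e x) * (e v - e x)) • (LinearMap.id : ℂ →ₗ[ℂ] ℂ))
      (Cor29Model.mult (e x) : (Cor29Model.planeStructure.comap e).A x ≃ₜ* ℂˣ) := by
  refine ⟨fun u => ?_, fun φ ψ χ h => ?_⟩
  · beta_reduce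
    exact iota_chartAct_eventually hV he hem hr hx u
  · beta_reduce at h
    set cφ : ℂ := (((Cor29Model.mult (e x) : (Cor29Model.planeStructure.comap e).A x ≃ₜ* ℂˣ) φ : ℂˣ) : ℂ) with hcφ
    set cψ : ℂ := (((Cor29Model.mult (e x) : (Cor29Model.planeStructure.comap e).A x ≃ₜ* ℂˣ) ψ : ℂˣ) : ℂ) with hcψ
    set cχ : ℂ := (((Cor29Model.mult (e x) : (Cor29Model.planeStructure.comap e).A x ≃ₜ* ℂˣ) χ : ℂˣ) : ℂ) with hcχ
    obtain ⟨v, -, hne, hv⟩ := exists_ne_mem_of_eventually hV hl hx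
      ((h.and (eventually_chart_act hV he hem hr hx cφ)).and
        ((eventually_chart_act hV he hem hr hx cψ).and
          ((eventually_chart_act hV he hem hr hx cχ).and (eventually_chart_act hV he hem hr hx (cφ + cψ)))))
    obtain ⟨⟨hvχ, -, hφ⟩, ⟨-, hψ⟩, ⟨hχm, -⟩, ⟨hsm, -⟩⟩ := hv
    -- `act χ v = act φ v +ₓ act ψ v` reads `e⁻¹(e x + c_χ w) = e⁻¹(e x + (c_φ + c_ψ) w)`, `w = e v − e x`
    have hvχ' : e' (e x + cχ * (e v - e x)) = e' (e x + (cφ + cψ) * (e v - e x)) := by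
      rw [hvχ, hφ, hψ]
      congr 1
      ring
    have hinj := chart_symm_injOn hr hχm hsm hvχ'
    have hvx : e v - e x ≠ 0 := sub_ne_zero.2 hne
    have : cχ * (e v - e x) = (cφ + cψ) * (e v - e x) := by linear_combination hinj
    exact mul_right_cancel₀ hvx this

/-- **Row Cor-29.b.r3 at the chart model** (independence of the neighbourhood): a scalar read off on ANY
neighbourhood `U` of `x` is the multiplier. [cite: MochizukiAbsTopIII2015, Corollary 2.9 (b) p.65] -/
theorem scalar_restrict_chart (hV : IsOpen V) (he : DifferentiableOn ℂ e V) (hem : MapsTo e V (ball 0 1))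
    (he' : DifferentiableOn ℂ e' (ball 0 1)) (hl : ∀ z ∈ V, e' (e z) = z)
    (hr : ∀ w ∈ ball (0 : ℂ) 1, e (e' w) = w) {x : ℂ} (hx : x ∈ V)
    (u : (Cor29Model.planeStructure.comap e).A x) (U : Set ℂ) (hU : U ∈ 𝓝 x) {a : ℂˣ}
    (ha : ∀ v ∈ U, (deriv e' (e x) * (e (e' (e x + (((Cor29Model.mult (e x) : (Cor29Model.planeStructure.comap e).A x ≃ₜ* ℂˣ) u : ℂˣ) : ℂ) * (e v - e x))) - e x)) •
      (LinearMap.id : ℂ →ₗ[ℂ] ℂ) = (a : ℂ) • ((deriv e' (e x) * (e v - e x)) • (LinearMap.id : ℂ →ₗ[ℂ] ℂ))) :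
    a = (Cor29Model.mult (e x) : (Cor29Model.planeStructure.comap e).A x ≃ₜ* ℂˣ) u := by
  obtain ⟨c, -, huniq⟩ := actionScalar_chart hV he hem he' hl hr hx u
  have h1 := huniq a (Filter.mem_of_superset hU fun v hv => ha v hv)
  have h2 := huniq ((Cor29Model.mult (e x) : (Cor29Model.planeStructure.comap e).A x ≃ₜ* ℂˣ) u) ?_
  · rw [h1, h2]
  · beta_reduce
    exact iota_chartAct_eventually hV he hem hr hx u

/-- **Row Cor-29.b.r4 at the chart model** (`ScalarCompatibleWithTrans`): the multiplier isomorphisms at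
two points of `V` are compatible with the transition isomorphism `𝒜_{x₁} ⥲ 𝒜_{x₂}` of the transported
structure (= the plane's translation-conjugation between the image points `e x₁`, `e x₂`; multipliers are
chart-invariant, cf. `HolomorphicCoresGermChartIndependence`).
[cite: MochizukiAbsTopIII2015, Corollary 2.9 (b) p.65] -/
theorem scalarCompatibleWithTrans_chart (x₁ x₂ : ℂ) :
    ScalarCompatibleWithTrans (𝕜 := ℂ) (Cor29Model.planeStructure.comap e) x₁ x₂
      (Cor29Model.mult (e x₁) : (Cor29Model.planeStructure.comap e).A x₁ ≃ₜ* ℂˣ)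
      (Cor29Model.mult (e x₂) : (Cor29Model.planeStructure.comap e).A x₂ ≃ₜ* ℂˣ) :=
  Cor29Model.scalarCompatibleWithTrans (e x₁) (e x₂)

end ArchimedeanReconstruction.Cor29ChartModel

end Literature.AnabelianGeometry.AbsoluteAnabelian

end
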